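import Summits.BirchSwinnertonDyer.BirchSwinnertonDyer.Theorems.AlignedTransportAtTwoMainConjectureOfRankZeroBSDAtTwoNarrowCubicNamedInputMenu
import Literature.NumberTheory.CubicFields.CubicFieldSignatureFromDiscriminant
import HarnessLib

/-!
# Route `AlignedTransportAtTwo`, crux C2 `MainConjectureOfRankZeroBSDAtTwo` (stmt-BirchSwinnertonDyer-22298):
# THE NAMED INPUTS IN DISCRIMINANT-SIGN CURRENCY — «μ₂ = 0 for every cubic field of NEGATIVE discriminant» ∧ «narrow μ₂⁺ = 0 for every cubic field
# of POSITIVE NON-SQUARE discriminant» + PRINT⁵ + MuIneqʳ ⟹ C2 BY NAME; and this pair ⟺ the signature-keyed pair ⟺ the one-binder form (W-free)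

HONEST FRAMING. WIDTH-5 attached prover seat `bsd-line-att-p4` g33 on line `birth` of the lead `bsd-line-att-p2`; `--supports`
stmt-BirchSwinnertonDyer-22298, closes nothing; BSD is NOT proved; crux C2, its verdict «blocked-on `Rank1Residual.GreenbergMuConjectureIrreducible`»
and every registered stub untouched. THEOREMS ONLY. The two hypotheses are OPEN instances of Iwasawa's `μ`-conjecture (negative discriminant) and of
Greenberg's conjecture in Kida's narrow form (positive non-square discriminant); nothing is asserted about them.

WHY. The classical literature indexes cubic fields by the SIGN of the field discriminant `d_F` («complex cubic fields» = `d_F < 0`, «totally real» =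
`d_F > 0`, Brill: `sign d_F = (−1)^{r₂}`; cyclic ⟺ `d_F ∈ ℤ²`). With this seat's Literature `CubicFields/CubicFieldSignatureFromDiscriminant`
(`IsTotallyReal F ⟺ 0 < d_F` for cubics, Mathlib `NumberField.sign_discr`) and `CubicFieldGaloisIffSquareDiscriminant` (`IsGalois ⟺ d_F ∈ ℤ²`) the
sign-split named inputs of `…NarrowCubicNamedInputSignSplit` take their textbook form — and the NEGATIVE-discriminant half needs NO «non-cyclic»
clause at all (a cubic field with `d_F < 0` is never Galois):

* §1 ★★ `discSplit_iff_signSplit` — W-free kernel equivalence of the two pairs of hypotheses; `discSplit_iff_narrowMu_nonGalois_cubic` (⟺ the one binder).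
* §2 ★★★ `crux_of_classicalMu_negDiscCubic_of_narrowClassicalMu_posDiscCubic` — **(N⁻) «∀ cubic number field F with d_F < 0: μ₂ = 0 along every
  cyclotomic ℤ₂-extension» ∧ (N⁺) «∀ cubic number field F with d_F > 0, d_F ∉ ℤ²: μ₂ = 0 along every cyclotomic ℤ₂-extension and bounded narrow
  2-defect» + PRINT⁵ + MuIneqʳ ⟹ `MainConjectureOfRankZeroBSDAtTwo`.**
Expected REF2 grade COROLLARY-OF-TREE. PARTITION: none; beyond-print theorem: no; BSD is NOT proved by any of this.

References: [Cohen1993] Prop. 4.8.11, §6.3.3; [Kida1982JFields] Thm. 1, Remark (ii); [Greenberg2001IwasawaPastPresent] §4; [Kato2004Asterisque] Thm. 17.4;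
[GreenbergLNM1716] Thm. 4.1; tree: `…NarrowCubicNamedInput{,SignSplit,Menu}`, `CubicFields/CubicField{GaloisIffSquareDiscriminant,SignatureFromDiscriminant}`.
-/

-- the Theorems namespace of this sub repeats the summit name by design (D-0017 nested layout)
set_option linter.dupNamespace false
set_option autoImplicit false

noncomputable section

open scoped NumberField IntermediateField

namespace Summit.BirchSwinnertonDyer.BirchSwinnertonDyer.Theorems.AlignedTransportAtTwoNarrowCubicNamedInputDiscSign

open NumberField Polynomial WeierstrassCurve IntermediateField Field CongruenceSubgroup
  Literature.NumberTheory.EllipticCurves Literature.NumberTheory.EllipticCurves.Greenberg1999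
  Literature.NumberTheory.EllipticCurves.ModularForms Literature.NumberTheory.EllipticCurves.Rank1Residual
  Literature.NumberTheory.EllipticCurves.Module
  Literature.NumberTheory.EllipticCurves.DokchitserDokchitser2012
  Literature.NumberTheory.EllipticCurves.ZpExtension Literature.NumberTheory.GaloisRepresentations
  Literature.NumberTheory.IwasawaTheory Literature.NumberTheory.NumberFields Literature.NumberTheory.CubicFields
  Summit.BirchSwinnertonDyer.Rank1Residual Summit.BirchSwinnertonDyer.Rank1Residual.X1.MuLambda
  Summit.BirchSwinnertonDyer.Rank1Residual.X5 Summit.BirchSwinnertonDyer.Rank1Residual.F1Sign2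
  Summit.BirchSwinnertonDyer.BirchSwinnertonDyer.Theorems.Rank1ResidualX1Defs
  Summit.BirchSwinnertonDyer.BirchSwinnertonDyer.Theses.AlignedTransportAtTwo
  Summit.BirchSwinnertonDyer.BirchSwinnertonDyer.Theorems.AlignedTransportAtTwoNarrowCubicNamedInput
  Summit.BirchSwinnertonDyer.BirchSwinnertonDyer.Theorems.AlignedTransportAtTwoNarrowCubicNamedInputSignSplit
  Summit.BirchSwinnertonDyer.BirchSwinnertonDyer.Theorems.AlignedTransportAtTwoNarrowCubicNamedInputMenu

/-! ## §1 Discriminant-sign pair ⟺ signature pair ⟺ one binder (W-free) -/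

/-- ★★ **THE DISCRIMINANT-SIGN PAIR ⟺ THE SIGNATURE PAIR** (W-free, kernel): (N⁻) «∀ cubic `F`, `d_F < 0` → `μ₂ = 0` for every cyclotomic `ℤ₂`-extension» ∧
(N⁺) «∀ cubic `F`, `d_F > 0` → `d_F ∉ ℤ²` → `μ₂ = 0` ∧ bounded narrow `2`-defect» ⟺ (Iμ⁻) «∀ cubic `F`, not Galois, not totally real → `μ₂ = 0`» ∧ (Gμ⁺) «∀ cubic
`F`, not Galois, totally real → `μ₂ = 0` ∧ bounded narrow `2`-defect» — by Brill for cubics (`IsTotallyReal ⟺ d_F > 0`) and «Galois ⟺ `d_F ∈ ℤ²`».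
[cite: Cohen1993, Prop. 4.8.11 and §6.3.3] [cite: Kida1982JFields, Thm. 1 and Remark (ii)] -/
theorem discSplit_iff_signSplit :
    ((∀ (F : Type) [Field F] [NumberField F], Module.finrank ℚ F = 3 → NumberField.discr F < 0 →
        ∀ κ : ZpExtension F 2, κ.IsCyclotomic → ClassicalMuVanishes κ) ∧
      ∀ (F : Type) [Field F] [NumberField F], Module.finrank ℚ F = 3 → 0 < NumberField.discr F → ¬ IsSquare (NumberField.discr F) →
        (∀ κ : ZpExtension F 2, κ.IsCyclotomic → ClassicalMuVanishes κ) ∧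
          ∃ D : ℕ, ∀ κ : ZpExtension F 2, κ.IsCyclotomic → ∀ n : ℕ, ∀ [NumberField ↥(κ.layer n)],
            padicValNat 2 (narrowClassNumber ↥(κ.layer n)) ≤ padicValNat 2 (classNumber ↥(κ.layer n)) + D) ↔
    ((∀ (F : Type) [Field F] [NumberField F], Module.finrank ℚ F = 3 → ¬ IsGalois ℚ F → ¬ IsTotallyReal F →
        ∀ κ : ZpExtension F 2, κ.IsCyclotomic → ClassicalMuVanishes κ) ∧
      ∀ (F : Type) [Field F] [NumberField F], Module.finrank ℚ F = 3 → ¬ IsGalois ℚ F → IsTotallyReal F →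
        (∀ κ : ZpExtension F 2, κ.IsCyclotomic → ClassicalMuVanishes κ) ∧
          ∃ D : ℕ, ∀ κ : ZpExtension F 2, κ.IsCyclotomic → ∀ n : ℕ, ∀ [NumberField ↥(κ.layer n)],
            padicValNat 2 (narrowClassNumber ↥(κ.layer n)) ≤ padicValNat 2 (classNumber ↥(κ.layer n)) + D) := by
  constructor
  · rintro ⟨hN, hP⟩
    refine ⟨fun F _ _ hF _ hT ↦ hN F hF ((not_isTotallyReal_iff_discr_neg_of_finrank_eq_three F hF).mp hT),
      fun F _ _ hF hG hT ↦ hP F hF ((isTotallyReal_iff_discr_pos_of_finrank_eq_three F hF).mp hT)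
        (not_isSquare_discr_of_not_isGalois_cubic F hF hG)⟩
  · rintro ⟨hC, hR⟩
    refine ⟨fun F _ _ hF hd ↦ hC F hF (not_isGalois_of_discr_neg_cubic F hF hd)
        ((not_isTotallyReal_iff_discr_neg_of_finrank_eq_three F hF).mpr hd),
      fun F _ _ hF hd hsq ↦ hR F hF (fun hG ↦ hsq ((isGalois_iff_isSquare_discr_cubic F hF).mp hG))
        ((isTotallyReal_iff_discr_pos_of_finrank_eq_three F hF).mpr hd)⟩

/-- **The discriminant-sign pair ⟺ the one-binder narrow input** «∀ non-Galois cubic `F`: `μ₂ = 0` ∧ bounded narrow `2`-defect» (through `…Menu.narrowMu_nonGalois_cubic_iff_signSplit`).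
[cite: Kida1982JFields, Thm. 1 and Remark (ii)] [cite: Cohen1993, Prop. 4.8.11] -/
theorem discSplit_iff_narrowMu_nonGalois_cubic :
    ((∀ (F : Type) [Field F] [NumberField F], Module.finrank ℚ F = 3 → NumberField.discr F < 0 →
        ∀ κ : ZpExtension F 2, κ.IsCyclotomic → ClassicalMuVanishes κ) ∧
      ∀ (F : Type) [Field F] [NumberField F], Module.finrank ℚ F = 3 → 0 < NumberField.discr F → ¬ IsSquare (NumberField.discr F) →
        (∀ κ : ZpExtension F 2, κ.IsCyclotomic → ClassicalMuVanishes κ) ∧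
          ∃ D : ℕ, ∀ κ : ZpExtension F 2, κ.IsCyclotomic → ∀ n : ℕ, ∀ [NumberField ↥(κ.layer n)],
            padicValNat 2 (narrowClassNumber ↥(κ.layer n)) ≤ padicValNat 2 (classNumber ↥(κ.layer n)) + D) ↔
    ∀ (F : Type) [Field F] [NumberField F], Module.finrank ℚ F = 3 → ¬ IsGalois ℚ F →
      (∀ κ : ZpExtension F 2, κ.IsCyclotomic → ClassicalMuVanishes κ) ∧
        ∃ D : ℕ, ∀ κ : ZpExtension F 2, κ.IsCyclotomic → ∀ n : ℕ, ∀ [NumberField ↥(κ.layer n)],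
          padicValNat 2 (narrowClassNumber ↥(κ.layer n)) ≤ padicValNat 2 (classNumber ↥(κ.layer n)) + D :=
  discSplit_iff_signSplit.trans narrowMu_nonGalois_cubic_iff_signSplit.symm

/-! ## §2 The crux by name in discriminant-sign currency -/

/-- ★★★ **(N⁻) «EVERY CUBIC NUMBER FIELD OF NEGATIVE DISCRIMINANT HAS `μ₂ = 0`» ∧ (N⁺) «EVERY CUBIC NUMBER FIELD OF POSITIVE NON-SQUARE DISCRIMINANT HAS
NARROW `μ₂⁺ = 0`» + PRINT⁵ + MuIneqʳ ⟹ C2 BY NAME.** Granted PRINT {Kato 17.4 (1)(2) at `2` (every curve), Greenberg 4.1, period unit, modularity, GZK} and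
the registered stub MuIneqʳ (`hI`): IF (N⁻) every cubic number field `F` with `d_F < 0` has `μ = 0` (growth form) along every cyclotomic `ℤ₂`-extension, AND
(N⁺) every cubic number field `F` with `d_F > 0`, `d_F ∉ ℤ²` has the same together with a bounded narrow `2`-defect `ord₂ h⁺(F_n) − ord₂ h(F_n)` (units of
all but boundedly many signatures), THEN `MainConjectureOfRankZeroBSDAtTwo`. The textbook indexing of the two OPEN conjectures (Iwasawa's `μ₂` for complex
cubic fields; Greenberg–Kida narrow `μ₂⁺` for totally real non-cyclic cubic fields); nothing is asserted about them. CONDITIONAL; the item stays open; BSD is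
NOT proved. [cite: Greenberg2001IwasawaPastPresent, §4 (Iwasawa's μ = 0 conjecture)] [cite: Kida1982JFields, Thm. 1 (p. 340) and Remark (ii) (p. 341)]
[cite: Cohen1993, Prop. 4.8.11 and §6.3.3] [cite: Kato2004Asterisque, Thm. 17.4 (p. 273) and §17.13 (pp. 279–280)]
[cite: GreenbergLNM1716, Thm. 4.1 (p. 102) and Conj. 1.11 (p. 58)] -/
theorem crux_of_classicalMu_negDiscCubic_of_narrowClassicalMu_posDiscCubic
    (h17 : ∀ (V : WeierstrassCurve ℚ) [V.IsElliptic] [V.IsGloballyMinimal] [NeZero (V.conductorNorm ℤ)]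
      (f : CuspForm (Gamma0 (V.conductorNorm ℤ)) 2), kato_divisibility_allPrimes V 2 (f := f))
    (hGr : Greenberg1999.thm41_charValue_rankZero_anyPrime)
    (hper : realPeriodRat_eq_unit_mul_plusPeriod_two) (hmod : nonempty_modularParametrizationData)
    (hGZK : rank_eq_analyticRank_of_analyticRank_le_one)
    (hI : ∀ (W : WeierstrassCurve ℚ) [W.IsElliptic] [W.IsGloballyMinimal], IsOrdinaryAt W 2 →
      (∀ x : ℚ, ¬ HasRationalTwoTorsionX W x) →
      ∀ (κ : ZpExtension ℚ 2) (γ : Field.absoluteGaloisGroup ℚ), κ.IsCyclotomic →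
      κ.IsTopGenerator γ → IsCyclotomicVariable 2 γ →
      ∀ ⦃N : ℕ⦄ [NeZero N] (f : CuspForm (Gamma0 N) 2), IsNewformOf W f →
      ∀ Gp : IwasawaAlgebra 2, iwasawaToPowerSeries 2 Gp = padicLFunction f (unitRoot W 2 : ℚ_[2]) →
      ∀ (D : W.SelmerDualData κ γ) (Yr : W.FineSelmerDualDataRelaxedInf κ γ),
        lengthAt (IwasawaAlgebra 2) D.X ⟨IwasawaAlgebra.augIdealP 2, IwasawaAlgebra.isPrime_augIdealP_holds 2⟩ ≤
          lengthAt (IwasawaAlgebra 2) (IwasawaAlgebra 2 ⧸ Ideal.span {Gp})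
              ⟨IwasawaAlgebra.augIdealP 2, IwasawaAlgebra.isPrime_augIdealP_holds 2⟩ +
            lengthAt (IwasawaAlgebra 2) Yr.X ⟨IwasawaAlgebra.augIdealP 2, IwasawaAlgebra.isPrime_augIdealP_holds 2⟩)
    (hNeg : ∀ (F : Type) [Field F] [NumberField F], Module.finrank ℚ F = 3 → NumberField.discr F < 0 →
      ∀ κ : ZpExtension F 2, κ.IsCyclotomic → ClassicalMuVanishes κ)
    (hPos : ∀ (F : Type) [Field F] [NumberField F], Module.finrank ℚ F = 3 → 0 < NumberField.discr F → ¬ IsSquare (NumberField.discr F) →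
      (∀ κ : ZpExtension F 2, κ.IsCyclotomic → ClassicalMuVanishes κ) ∧
        ∃ D : ℕ, ∀ κ : ZpExtension F 2, κ.IsCyclotomic → ∀ n : ℕ, ∀ [NumberField ↥(κ.layer n)],
          padicValNat 2 (narrowClassNumber ↥(κ.layer n)) ≤ padicValNat 2 (classNumber ↥(κ.layer n)) + D) :
    MainConjectureOfRankZeroBSDAtTwo := by
  obtain ⟨hC, hR⟩ := discSplit_iff_signSplit.mp ⟨hNeg, hPos⟩
  exact crux_of_classicalMu_complexCubic_of_narrowClassicalMu_totallyRealCubic h17 hGr hper hmod hGZK hI hC hR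

end Summit.BirchSwinnertonDyer.BirchSwinnertonDyer.Theorems.AlignedTransportAtTwoNarrowCubicNamedInputDiscSign

end
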